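import Mathlib
import Summits.ValiantsHypothesis.ValiantsHypothesis.Theorems.NewtonUnitEquationsDissociatedUniformTotalsLaw
import Summits.ValiantsHypothesis.ValiantsHypothesis.Theorems.NewtonUnitEquationsDissociatedUniformTotalsLawUnion
import Summits.ValiantsHypothesis.ValiantsHypothesis.Theorems.NewtonUnitEquationsDissociatedUniformTotalsLawIntervalUnion
import Summits.ValiantsHypothesis.ValiantsHypothesis.Theorems.NewtonUnitEquationsDissociatedUniformTotalsLawIntervalUnionBandRuns
import Summits.ValiantsHypothesis.ValiantsHypothesis.Theorems.NewtonUnitEquationsDissociatedUniformTotalsLawThirdCurveRuns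
import HarnessLib

/-!
# Crux `NewtonUnitEquations.DissociatedUniform` (stmt-ValiantsHypothesis-5905), `n = 3` totals law of model (Q**):
# the RUNS LAW in an arbitrary finite abelian group — third curves factoring through a cyclic quotient

`…TotalsLawThirdCurveRuns` proved `T(a,b,c) ≤ (2 + 24·R(c))·q²` over `ℤ/q`, `R(c)` the number of runs of `c`.  Over an arbitrary
finite abelian group `G`, a third curve that factors as `c = g ∘ φ` through a homomorphism `φ : G →+ ℤ/q` (it depends on one cyclic
coordinate) obeys the same law with the runs of `g`:
* `classVert_le_bandRuns : V_s ≤ (2 + 32·R(g))·|G|` — POINTWISE, every class, ALL `a b : G → ℝ²`;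
* `totalVert_le_bandRuns : T(a, b, g ∘ φ) ≤ (2 + 32·R(g))·|G|²`.
(Constant `g`: the constant stratum `2|G|²`; `g` with `R` runs: its level sets are unions of runs of `ℤ/q`
(`…ThirdCurveRuns.level_eq_biUnion_runs`), so the level sets of `g ∘ φ` are unions of BANDS and `…IntervalUnionBandRuns.unionVert_bands_le`
applies.)  Honest label: `TotalsLawThree C` remains OPEN and is asserted nowhere; nothing here bears on VP ≠ VNP. [folklore]
-/

set_option linter.dupNamespace false -- `ValiantsHypothesis.ValiantsHypothesis` (summit = problem) in every name

open Finset
open scoped Pointwise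

namespace Summit.ValiantsHypothesis.ValiantsHypothesis.Theorems.NewtonUnitEquationsDissociatedUniform

namespace TotalsLaw

/-! ### The runs law in an arbitrary finite abelian group: third curves factoring through a cyclic quotient -/

section BandRunsLaw

variable {G : Type*} [AddCommGroup G] [Fintype G] [DecidableEq G] {q : ℕ} [NeZero q] [DecidableEq (Fin 2 → ℝ)]

/-- A level set of `g ∘ φ` is a union of `#{runs of that value}` bands: `#vert conv U_s((g∘φ)⁻¹ v) ≤ #{z ∈ runStarts g : g z = v}·32|G|`.
[folklore] -/
theorem unionVert_level_le_bandRuns {g : ZMod q → (Fin 2 → ℝ)} {z₀ : ZMod q} (hz₀ : z₀ ∈ runStarts g) (φ : G →+ ZMod q)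
    (a b : G → (Fin 2 → ℝ)) (v : Fin 2 → ℝ) (s : G) :
    unionVert a b ((g ∘ φ) ⁻¹' {v}) s ≤ ((runStarts g).filter fun z => g z = v).card * (32 * Fintype.card G) := by
  have h := unionVert_bands_le a b ((runStarts g).filter fun z => g z = v) (fun _ => φ) (fun z => z.val)
    (fun z => runLen hz₀ z) s
  have hlevel : (g ∘ φ) ⁻¹' {v} =
      ⋃ z ∈ (runStarts g).filter (fun z => g z = v), φ ⁻¹' ((cycInterval q z.val (runLen hz₀ z) : Finset (ZMod q)) :
        Set (ZMod q)) := by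
    rw [Set.preimage_comp, level_eq_biUnion_runs hz₀ v, Set.preimage_iUnion₂]
  rw [hlevel]
  exact h

/-- **THE RUNS LAW IN AN ARBITRARY FINITE ABELIAN GROUP, POINTWISE:** if the third curve factors as `c = g ∘ φ` through a homomorphism
`φ : G →+ ℤ/q`, then `V_s ≤ (2 + 32·R(g))·|G|` for every class `s` and ALL `a b : G → ℝ²`, `R(g) = #runStarts g` the number of runs
of `g` around `ℤ/q`. -/
theorem classVert_le_bandRuns (φ : G →+ ZMod q) (g : ZMod q → (Fin 2 → ℝ)) (a b : G → (Fin 2 → ℝ)) (s : G) :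
    classVert a b (g ∘ φ) s ≤ (2 + 32 * (runStarts g).card) * Fintype.card G := by
  classical
  refine (classVert_le_sum_unionVert a b (g ∘ φ) s).trans ?_
  rcases (runStarts g).eq_empty_or_nonempty with h0 | ⟨z₀, hz₀⟩
  · -- constant `g`: one level set, `= univ`
    have hconst : ∀ x : G, (g ∘ φ) x = g 0 := fun x => apply_eq_of_runStarts_eq_empty h0 0 (φ x)
    have himg : Finset.univ.image (g ∘ φ) = {g 0} := by
      refine Finset.eq_singleton_iff_unique_mem.2 ⟨?_, fun v hv => ?_⟩
      · obtain ⟨x⟩ := (inferInstance : Nonempty G)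
        exact Finset.mem_image.2 ⟨x, Finset.mem_univ _, hconst x⟩
      · obtain ⟨x, -, rfl⟩ := Finset.mem_image.1 hv
        exact hconst x
    have hlev : (g ∘ φ) ⁻¹' {g 0} = Set.univ := Set.eq_univ_of_forall fun x => hconst x
    rw [himg, Finset.sum_singleton, hlev, h0, Finset.card_empty]
    have := unionVert_univ_le a b s
    omega
  · calc ∑ v ∈ Finset.univ.image (g ∘ φ), unionVert a b ((g ∘ φ) ⁻¹' {v}) s
        ≤ ∑ v ∈ Finset.univ.image (g ∘ φ), ((runStarts g).filter fun z => g z = v).card * (32 * Fintype.card G) :=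
          Finset.sum_le_sum fun v _ => unionVert_level_le_bandRuns hz₀ φ a b v s
      _ ≤ ∑ v ∈ Finset.univ.image g, ((runStarts g).filter fun z => g z = v).card * (32 * Fintype.card G) := by
          refine Finset.sum_le_sum_of_subset fun v hv => ?_
          obtain ⟨x, -, rfl⟩ := Finset.mem_image.1 hv
          exact Finset.mem_image.2 ⟨φ x, Finset.mem_univ _, rfl⟩
      _ = (runStarts g).card * (32 * Fintype.card G) := by
          rw [← Finset.sum_mul, ← Finset.card_eq_sum_card_fiberwise fun z _ => Finset.mem_coe.2
            (Finset.mem_image.2 ⟨z, Finset.mem_univ _, rfl⟩)]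
      _ ≤ (2 + 32 * (runStarts g).card) * Fintype.card G := by nlinarith

/-- **… and in TOTAL:** `T(a, b, g ∘ φ) ≤ (2 + 32·R(g))·|G|²` for ALL `a b : G → ℝ²`, every homomorphism `φ : G →+ ℤ/q` and every
`g : ℤ/q → ℝ²` with `R(g)` runs. -/
theorem totalVert_le_bandRuns (φ : G →+ ZMod q) (g : ZMod q → (Fin 2 → ℝ)) (a b : G → (Fin 2 → ℝ)) :
    totalVert a b (g ∘ φ) ≤ (2 + 32 * (runStarts g).card) * Fintype.card G ^ 2 := by
  unfold totalVert
  calc ∑ s, classVert a b (g ∘ φ) s ≤ ∑ _s : G, (2 + 32 * (runStarts g).card) * Fintype.card G :=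
        Finset.sum_le_sum fun s _ => classVert_le_bandRuns φ g a b s
    _ = (2 + 32 * (runStarts g).card) * Fintype.card G ^ 2 := by rw [Finset.sum_const, Finset.card_univ, smul_eq_mul]; ring

end BandRunsLaw

end TotalsLaw

end Summit.ValiantsHypothesis.ValiantsHypothesis.Theorems.NewtonUnitEquationsDissociatedUniform
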